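import Mathlib
import Summits.Ventures.PercRepro2.HCov
import Summits.Ventures.PercRepro2.HCovDiag
import Summits.Ventures.PercRepro2.RootLeafUSigns
import Summits.Ventures.PercRepro2.RootLeafUSecond
import Summits.Ventures.PercRepro2.RootLeafUHalf

/-!
# W1 on the diagonal `o = b`: `0 ≤ T2 p ends b a₂ c b u` (blind cell PercRepro2, p4 g16; S3 (G4-u)
item (ac-2), the corner of the 3-coin class «`b` adjacent to `a₂, u, o`»; no definitions)

With the mark `o` placed at `b` the second root-leaf coefficient is a polynomial with NONNEGATIVE
coefficients (54 monomials, coefficients in `{2, 4, 6, 8}`) in thirteen atoms — the nine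
`Q`-partition atoms `P(PD ∩ bL)`, `P(PD ∩ bK)`, `P(PD ∩ b∅)`, the same for `T` and `T′`
(HCovDiag's `prob_split_b`), and the four world-0 atoms `P(c ∈ K, b ∈ K)`, `P(c ∈ K, b ∉ K)`,
`P(c ∉ K, b ∈ K)`, `P(c ∉ K, b ∉ K)` (the unconditional masses `hb`, `d0`, `e0`, `P(Ω)` split by the
two events) — `T2_diag_o_eq`, a mass identity; hence **`T2_nonneg_diag_o`** by positivity.  This is
the `q²(1−q)`-coefficient of HCovDiag's positive cubic `Gc_diag_eq` for a root pendant at `u`: the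
`q`-mixtures of the atoms keep every coefficient positive.  Companion of RootLeafUDiagT2 (the
diagonal `b = c`); both are corners of the 3-coin programme of proofs/P4-G16-COIN3.md.
-/

namespace Summit.Ventures.PercRepro2

open UnionCluster CovForm HCovDiag

namespace RootLeafU

namespace DiagO

variable {V : Type*} {E : Type*} [Fintype E] [DecidableEq E] [Fintype V] [DecidableEq V]
  {R : Type*} [Field R] [LinearOrder R] [IsStrictOrderedRing R]

section Theorem

omit [Fintype E] [DecidableEq E] [Fintype V] [DecidableEq V] in
/-- The 54-monomial cubic of `T2_diag_o_eq` is nonnegative on nonnegative atoms. -/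
lemma poly_nonneg {x1 x2 x3 x4 x5 x6 x7 x8 x9 x10 x11 x12 x13 : R} (h1 : 0 ≤ x1) (h2 : 0 ≤ x2)
    (h3 : 0 ≤ x3) (h4 : 0 ≤ x4) (h5 : 0 ≤ x5) (h6 : 0 ≤ x6) (h7 : 0 ≤ x7) (h8 : 0 ≤ x8) (h9 : 0 ≤ x9)
    (h10 : 0 ≤ x10) (h11 : 0 ≤ x11) (h12 : 0 ≤ x12) (h13 : 0 ≤ x13) :
    0 ≤ 2 * x10 * x3 * x1 +
        4 * x10 * x3 * x4 +
        4 * x10 * x2 * x1 +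
        4 * x10 * x2 * x4 +
        2 * x10 * x2 * x9 +
        4 * x10 * x2 * x7 +
        4 * x10 * x1 * x4 +
        2 * x10 * x1 * x9 +
        4 * x10 * x1 * x7 +
        4 * x10 * x1 ^ 2 +
        2 * x11 * x3 * x4 +
        2 * x11 * x3 * x8 +
        2 * x11 * x2 * x1 +
        2 * x11 * x2 * x4 +
        2 * x11 * x2 * x7 +
        2 * x11 * x1 * x4 +
        2 * x11 * x1 * x7 +
        2 * x11 * x1 ^ 2 +
        4 * x12 * x3 * x1 +
        6 * x12 * x3 * x4 +
        2 * x12 * x3 * x7 +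
        8 * x12 * x2 * x1 +
        8 * x12 * x2 * x4 +
        4 * x12 * x2 * x9 +
        8 * x12 * x2 * x7 +
        2 * x12 * x1 * x6 +
        4 * x12 * x1 * x5 +
        4 * x12 * x1 * x4 +
        2 * x12 * x1 * x9 +
        4 * x12 * x1 * x8 +
        4 * x12 * x1 * x7 +
        4 * x12 * x1 ^ 2 +
        2 * x12 * x6 * x4 +
        2 * x12 * x6 * x7 +
        4 * x12 * x5 * x4 +
        2 * x12 * x5 * x9 +
        4 * x12 * x5 * x7 +
        4 * x12 * x4 * x8 +
        2 * x12 * x9 * x8 +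
        4 * x12 * x8 * x7 +
        4 * x13 * x3 * x4 +
        4 * x13 * x3 * x8 +
        4 * x13 * x2 * x1 +
        6 * x13 * x2 * x4 +
        2 * x13 * x2 * x7 +
        2 * x13 * x1 * x5 +
        6 * x13 * x1 * x8 +
        2 * x13 * x6 * x4 +
        2 * x13 * x6 * x8 +
        4 * x13 * x5 * x4 +
        2 * x13 * x4 * x9 +
        8 * x13 * x4 * x8 +
        2 * x13 * x9 * x8 +
        4 * x13 * x8 * x7
    := by
  positivity

variable (p : E → R) (ends : E → Sym2 V) (a₂ c b u : V)

/-- **The diagonal identity `o = b`**: `T2(o = b)` as a positive polynomial in the thirteen atoms. -/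
theorem T2_diag_o_eq :
    T2 p ends b a₂ c b u =
        2 * prob p (connEvent ends a₂ c ∩ connEvent ends a₂ b) * prob p (PDEvent ends u a₂ c ∩ (connEvent ends u b)ᶜ ∩ (connEvent ends a₂ b)ᶜ) * prob p (PDEvent ends u a₂ c ∩ connEvent ends u b) +
        4 * prob p (connEvent ends a₂ c ∩ connEvent ends a₂ b) * prob p (PDEvent ends u a₂ c ∩ (connEvent ends u b)ᶜ ∩ (connEvent ends a₂ b)ᶜ) * prob p (TEvent ends u a₂ c ∩ connEvent ends u b) +
        4 * prob p (connEvent ends a₂ c ∩ connEvent ends a₂ b) * prob p (PDEvent ends u a₂ c ∩ connEvent ends a₂ b) * prob p (PDEvent ends u a₂ c ∩ connEvent ends u b) +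
        4 * prob p (connEvent ends a₂ c ∩ connEvent ends a₂ b) * prob p (PDEvent ends u a₂ c ∩ connEvent ends a₂ b) * prob p (TEvent ends u a₂ c ∩ connEvent ends u b) +
        2 * prob p (connEvent ends a₂ c ∩ connEvent ends a₂ b) * prob p (PDEvent ends u a₂ c ∩ connEvent ends a₂ b) * prob p (TEvent ends a₂ u c ∩ (connEvent ends u b)ᶜ ∩ (connEvent ends a₂ b)ᶜ) +
        4 * prob p (connEvent ends a₂ c ∩ connEvent ends a₂ b) * prob p (PDEvent ends u a₂ c ∩ connEvent ends a₂ b) * prob p (TEvent ends a₂ u c ∩ connEvent ends u b) +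
        4 * prob p (connEvent ends a₂ c ∩ connEvent ends a₂ b) * prob p (PDEvent ends u a₂ c ∩ connEvent ends u b) * prob p (TEvent ends u a₂ c ∩ connEvent ends u b) +
        2 * prob p (connEvent ends a₂ c ∩ connEvent ends a₂ b) * prob p (PDEvent ends u a₂ c ∩ connEvent ends u b) * prob p (TEvent ends a₂ u c ∩ (connEvent ends u b)ᶜ ∩ (connEvent ends a₂ b)ᶜ) +
        4 * prob p (connEvent ends a₂ c ∩ connEvent ends a₂ b) * prob p (PDEvent ends u a₂ c ∩ connEvent ends u b) * prob p (TEvent ends a₂ u c ∩ connEvent ends u b) +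
        4 * prob p (connEvent ends a₂ c ∩ connEvent ends a₂ b) * prob p (PDEvent ends u a₂ c ∩ connEvent ends u b) ^ 2 +
        2 * prob p (connEvent ends a₂ c ∩ (connEvent ends a₂ b)ᶜ) * prob p (PDEvent ends u a₂ c ∩ (connEvent ends u b)ᶜ ∩ (connEvent ends a₂ b)ᶜ) * prob p (TEvent ends u a₂ c ∩ connEvent ends u b) +
        2 * prob p (connEvent ends a₂ c ∩ (connEvent ends a₂ b)ᶜ) * prob p (PDEvent ends u a₂ c ∩ (connEvent ends u b)ᶜ ∩ (connEvent ends a₂ b)ᶜ) * prob p (TEvent ends a₂ u c ∩ connEvent ends a₂ b) +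
        2 * prob p (connEvent ends a₂ c ∩ (connEvent ends a₂ b)ᶜ) * prob p (PDEvent ends u a₂ c ∩ connEvent ends a₂ b) * prob p (PDEvent ends u a₂ c ∩ connEvent ends u b) +
        2 * prob p (connEvent ends a₂ c ∩ (connEvent ends a₂ b)ᶜ) * prob p (PDEvent ends u a₂ c ∩ connEvent ends a₂ b) * prob p (TEvent ends u a₂ c ∩ connEvent ends u b) +
        2 * prob p (connEvent ends a₂ c ∩ (connEvent ends a₂ b)ᶜ) * prob p (PDEvent ends u a₂ c ∩ connEvent ends a₂ b) * prob p (TEvent ends a₂ u c ∩ connEvent ends u b) +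
        2 * prob p (connEvent ends a₂ c ∩ (connEvent ends a₂ b)ᶜ) * prob p (PDEvent ends u a₂ c ∩ connEvent ends u b) * prob p (TEvent ends u a₂ c ∩ connEvent ends u b) +
        2 * prob p (connEvent ends a₂ c ∩ (connEvent ends a₂ b)ᶜ) * prob p (PDEvent ends u a₂ c ∩ connEvent ends u b) * prob p (TEvent ends a₂ u c ∩ connEvent ends u b) +
        2 * prob p (connEvent ends a₂ c ∩ (connEvent ends a₂ b)ᶜ) * prob p (PDEvent ends u a₂ c ∩ connEvent ends u b) ^ 2 +
        4 * prob p ((connEvent ends a₂ c)ᶜ ∩ connEvent ends a₂ b) * prob p (PDEvent ends u a₂ c ∩ (connEvent ends u b)ᶜ ∩ (connEvent ends a₂ b)ᶜ) * prob p (PDEvent ends u a₂ c ∩ connEvent ends u b) +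
        6 * prob p ((connEvent ends a₂ c)ᶜ ∩ connEvent ends a₂ b) * prob p (PDEvent ends u a₂ c ∩ (connEvent ends u b)ᶜ ∩ (connEvent ends a₂ b)ᶜ) * prob p (TEvent ends u a₂ c ∩ connEvent ends u b) +
        2 * prob p ((connEvent ends a₂ c)ᶜ ∩ connEvent ends a₂ b) * prob p (PDEvent ends u a₂ c ∩ (connEvent ends u b)ᶜ ∩ (connEvent ends a₂ b)ᶜ) * prob p (TEvent ends a₂ u c ∩ connEvent ends u b) +
        8 * prob p ((connEvent ends a₂ c)ᶜ ∩ connEvent ends a₂ b) * prob p (PDEvent ends u a₂ c ∩ connEvent ends a₂ b) * prob p (PDEvent ends u a₂ c ∩ connEvent ends u b) +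
        8 * prob p ((connEvent ends a₂ c)ᶜ ∩ connEvent ends a₂ b) * prob p (PDEvent ends u a₂ c ∩ connEvent ends a₂ b) * prob p (TEvent ends u a₂ c ∩ connEvent ends u b) +
        4 * prob p ((connEvent ends a₂ c)ᶜ ∩ connEvent ends a₂ b) * prob p (PDEvent ends u a₂ c ∩ connEvent ends a₂ b) * prob p (TEvent ends a₂ u c ∩ (connEvent ends u b)ᶜ ∩ (connEvent ends a₂ b)ᶜ) +
        8 * prob p ((connEvent ends a₂ c)ᶜ ∩ connEvent ends a₂ b) * prob p (PDEvent ends u a₂ c ∩ connEvent ends a₂ b) * prob p (TEvent ends a₂ u c ∩ connEvent ends u b) +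
        2 * prob p ((connEvent ends a₂ c)ᶜ ∩ connEvent ends a₂ b) * prob p (PDEvent ends u a₂ c ∩ connEvent ends u b) * prob p (TEvent ends u a₂ c ∩ (connEvent ends u b)ᶜ ∩ (connEvent ends a₂ b)ᶜ) +
        4 * prob p ((connEvent ends a₂ c)ᶜ ∩ connEvent ends a₂ b) * prob p (PDEvent ends u a₂ c ∩ connEvent ends u b) * prob p (TEvent ends u a₂ c ∩ connEvent ends a₂ b) +
        4 * prob p ((connEvent ends a₂ c)ᶜ ∩ connEvent ends a₂ b) * prob p (PDEvent ends u a₂ c ∩ connEvent ends u b) * prob p (TEvent ends u a₂ c ∩ connEvent ends u b) +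
        2 * prob p ((connEvent ends a₂ c)ᶜ ∩ connEvent ends a₂ b) * prob p (PDEvent ends u a₂ c ∩ connEvent ends u b) * prob p (TEvent ends a₂ u c ∩ (connEvent ends u b)ᶜ ∩ (connEvent ends a₂ b)ᶜ) +
        4 * prob p ((connEvent ends a₂ c)ᶜ ∩ connEvent ends a₂ b) * prob p (PDEvent ends u a₂ c ∩ connEvent ends u b) * prob p (TEvent ends a₂ u c ∩ connEvent ends a₂ b) +
        4 * prob p ((connEvent ends a₂ c)ᶜ ∩ connEvent ends a₂ b) * prob p (PDEvent ends u a₂ c ∩ connEvent ends u b) * prob p (TEvent ends a₂ u c ∩ connEvent ends u b) +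
        4 * prob p ((connEvent ends a₂ c)ᶜ ∩ connEvent ends a₂ b) * prob p (PDEvent ends u a₂ c ∩ connEvent ends u b) ^ 2 +
        2 * prob p ((connEvent ends a₂ c)ᶜ ∩ connEvent ends a₂ b) * prob p (TEvent ends u a₂ c ∩ (connEvent ends u b)ᶜ ∩ (connEvent ends a₂ b)ᶜ) * prob p (TEvent ends u a₂ c ∩ connEvent ends u b) +
        2 * prob p ((connEvent ends a₂ c)ᶜ ∩ connEvent ends a₂ b) * prob p (TEvent ends u a₂ c ∩ (connEvent ends u b)ᶜ ∩ (connEvent ends a₂ b)ᶜ) * prob p (TEvent ends a₂ u c ∩ connEvent ends u b) +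
        4 * prob p ((connEvent ends a₂ c)ᶜ ∩ connEvent ends a₂ b) * prob p (TEvent ends u a₂ c ∩ connEvent ends a₂ b) * prob p (TEvent ends u a₂ c ∩ connEvent ends u b) +
        2 * prob p ((connEvent ends a₂ c)ᶜ ∩ connEvent ends a₂ b) * prob p (TEvent ends u a₂ c ∩ connEvent ends a₂ b) * prob p (TEvent ends a₂ u c ∩ (connEvent ends u b)ᶜ ∩ (connEvent ends a₂ b)ᶜ) +
        4 * prob p ((connEvent ends a₂ c)ᶜ ∩ connEvent ends a₂ b) * prob p (TEvent ends u a₂ c ∩ connEvent ends a₂ b) * prob p (TEvent ends a₂ u c ∩ connEvent ends u b) +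
        4 * prob p ((connEvent ends a₂ c)ᶜ ∩ connEvent ends a₂ b) * prob p (TEvent ends u a₂ c ∩ connEvent ends u b) * prob p (TEvent ends a₂ u c ∩ connEvent ends a₂ b) +
        2 * prob p ((connEvent ends a₂ c)ᶜ ∩ connEvent ends a₂ b) * prob p (TEvent ends a₂ u c ∩ (connEvent ends u b)ᶜ ∩ (connEvent ends a₂ b)ᶜ) * prob p (TEvent ends a₂ u c ∩ connEvent ends a₂ b) +
        4 * prob p ((connEvent ends a₂ c)ᶜ ∩ connEvent ends a₂ b) * prob p (TEvent ends a₂ u c ∩ connEvent ends a₂ b) * prob p (TEvent ends a₂ u c ∩ connEvent ends u b) +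
        4 * prob p ((connEvent ends a₂ c)ᶜ ∩ (connEvent ends a₂ b)ᶜ) * prob p (PDEvent ends u a₂ c ∩ (connEvent ends u b)ᶜ ∩ (connEvent ends a₂ b)ᶜ) * prob p (TEvent ends u a₂ c ∩ connEvent ends u b) +
        4 * prob p ((connEvent ends a₂ c)ᶜ ∩ (connEvent ends a₂ b)ᶜ) * prob p (PDEvent ends u a₂ c ∩ (connEvent ends u b)ᶜ ∩ (connEvent ends a₂ b)ᶜ) * prob p (TEvent ends a₂ u c ∩ connEvent ends a₂ b) +
        4 * prob p ((connEvent ends a₂ c)ᶜ ∩ (connEvent ends a₂ b)ᶜ) * prob p (PDEvent ends u a₂ c ∩ connEvent ends a₂ b) * prob p (PDEvent ends u a₂ c ∩ connEvent ends u b) +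
        6 * prob p ((connEvent ends a₂ c)ᶜ ∩ (connEvent ends a₂ b)ᶜ) * prob p (PDEvent ends u a₂ c ∩ connEvent ends a₂ b) * prob p (TEvent ends u a₂ c ∩ connEvent ends u b) +
        2 * prob p ((connEvent ends a₂ c)ᶜ ∩ (connEvent ends a₂ b)ᶜ) * prob p (PDEvent ends u a₂ c ∩ connEvent ends a₂ b) * prob p (TEvent ends a₂ u c ∩ connEvent ends u b) +
        2 * prob p ((connEvent ends a₂ c)ᶜ ∩ (connEvent ends a₂ b)ᶜ) * prob p (PDEvent ends u a₂ c ∩ connEvent ends u b) * prob p (TEvent ends u a₂ c ∩ connEvent ends a₂ b) +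
        6 * prob p ((connEvent ends a₂ c)ᶜ ∩ (connEvent ends a₂ b)ᶜ) * prob p (PDEvent ends u a₂ c ∩ connEvent ends u b) * prob p (TEvent ends a₂ u c ∩ connEvent ends a₂ b) +
        2 * prob p ((connEvent ends a₂ c)ᶜ ∩ (connEvent ends a₂ b)ᶜ) * prob p (TEvent ends u a₂ c ∩ (connEvent ends u b)ᶜ ∩ (connEvent ends a₂ b)ᶜ) * prob p (TEvent ends u a₂ c ∩ connEvent ends u b) +
        2 * prob p ((connEvent ends a₂ c)ᶜ ∩ (connEvent ends a₂ b)ᶜ) * prob p (TEvent ends u a₂ c ∩ (connEvent ends u b)ᶜ ∩ (connEvent ends a₂ b)ᶜ) * prob p (TEvent ends a₂ u c ∩ connEvent ends a₂ b) +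
        4 * prob p ((connEvent ends a₂ c)ᶜ ∩ (connEvent ends a₂ b)ᶜ) * prob p (TEvent ends u a₂ c ∩ connEvent ends a₂ b) * prob p (TEvent ends u a₂ c ∩ connEvent ends u b) +
        2 * prob p ((connEvent ends a₂ c)ᶜ ∩ (connEvent ends a₂ b)ᶜ) * prob p (TEvent ends u a₂ c ∩ connEvent ends u b) * prob p (TEvent ends a₂ u c ∩ (connEvent ends u b)ᶜ ∩ (connEvent ends a₂ b)ᶜ) +
        8 * prob p ((connEvent ends a₂ c)ᶜ ∩ (connEvent ends a₂ b)ᶜ) * prob p (TEvent ends u a₂ c ∩ connEvent ends u b) * prob p (TEvent ends a₂ u c ∩ connEvent ends a₂ b) +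
        2 * prob p ((connEvent ends a₂ c)ᶜ ∩ (connEvent ends a₂ b)ᶜ) * prob p (TEvent ends a₂ u c ∩ (connEvent ends u b)ᶜ ∩ (connEvent ends a₂ b)ᶜ) * prob p (TEvent ends a₂ u c ∩ connEvent ends a₂ b) +
        4 * prob p ((connEvent ends a₂ c)ᶜ ∩ (connEvent ends a₂ b)ᶜ) * prob p (TEvent ends a₂ u c ∩ connEvent ends a₂ b) * prob p (TEvent ends a₂ u c ∩ connEvent ends u b)
    := by
  have hD := prob_split_b p ends u a₂ b (PDEvent ends u a₂ c) (PD_sub ends u a₂ c)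
  have ht := prob_split_b p ends u a₂ b (TEvent ends u a₂ c) (T_sub ends u a₂ c)
  have htp := prob_split_b p ends u a₂ b (TEvent ends a₂ u c) (T'_sub ends u a₂ c)
  have hhb : prob p (connEvent ends a₂ b) =
      prob p (connEvent ends a₂ c ∩ connEvent ends a₂ b) + prob p ((connEvent ends a₂ c)ᶜ ∩ connEvent ends a₂ b) := by
    have h := prob_inter_add_prob_inter_compl p (connEvent ends a₂ b) (connEvent ends a₂ c)
    rw [Set.inter_comm (connEvent ends a₂ b) (connEvent ends a₂ c),
      Set.inter_comm (connEvent ends a₂ b) (connEvent ends a₂ c)ᶜ] at h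
    linarith
  have hd0 : prob p (connEvent ends a₂ c)ᶜ =
      prob p ((connEvent ends a₂ c)ᶜ ∩ connEvent ends a₂ b) + prob p ((connEvent ends a₂ c)ᶜ ∩ (connEvent ends a₂ b)ᶜ) := by
    have h := prob_inter_add_prob_inter_compl p (connEvent ends a₂ c)ᶜ (connEvent ends a₂ b)
    linarith
  have hS : prob p Set.univ =
      prob p (connEvent ends a₂ c ∩ connEvent ends a₂ b) + prob p (connEvent ends a₂ c ∩ (connEvent ends a₂ b)ᶜ) +
        prob p ((connEvent ends a₂ c)ᶜ ∩ connEvent ends a₂ b) + prob p ((connEvent ends a₂ c)ᶜ ∩ (connEvent ends a₂ b)ᶜ) := by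
    have h1 := prob_inter_add_prob_inter_compl p Set.univ (connEvent ends a₂ c)
    have h2 := prob_inter_add_prob_inter_compl p (connEvent ends a₂ c) (connEvent ends a₂ b)
    have h3 := prob_inter_add_prob_inter_compl p (connEvent ends a₂ c)ᶜ (connEvent ends a₂ b)
    rw [Set.univ_inter, Set.univ_inter] at h1
    linarith
  rw [T2_eq_T2oL_add_T2oK]
  unfold T2oL T2oK Ee EQb3 PDb EQ3
  rw [gap_eq_Q p ends u a₂ b, Qsplit p ends u a₂ c (connEvent ends a₂ b),
    Qsplit p ends u a₂ c (connEvent ends u b), Qsplit_univ p ends u a₂ c, Set.inter_self, Set.inter_self,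
    inter_both_eq_empty ends u a₂ b _ (PD_sub ends u a₂ c), inter_both_eq_empty ends u a₂ b _ (T_sub ends u a₂ c),
    inter_both_eq_empty' ends u a₂ b _ (PD_sub ends u a₂ c), inter_both_eq_empty' ends u a₂ b _ (T'_sub ends u a₂ c),
    prob_empty, avoidAll_singleton_eq ends a₂ c, hD, ht, htp, hhb, hd0, hS]
  ring

/-- **W1 on the diagonal `o = b`**: `0 ≤ T2 p ends b a₂ c b u`. -/
theorem T2_nonneg_diag_o (hp : IsProbVec p) : 0 ≤ T2 p ends b a₂ c b u := by
  rw [T2_diag_o_eq]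
  exact poly_nonneg (prob_nonneg hp _) (prob_nonneg hp _) (prob_nonneg hp _) (prob_nonneg hp _)
    (prob_nonneg hp _) (prob_nonneg hp _) (prob_nonneg hp _) (prob_nonneg hp _) (prob_nonneg hp _)
    (prob_nonneg hp _) (prob_nonneg hp _) (prob_nonneg hp _) (prob_nonneg hp _)

end Theorem

end DiagO

end RootLeafU

end Summit.Ventures.PercRepro2
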